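import Mathlib.Algebra.BigOperators.Fin
import Mathlib.Algebra.BigOperators.Ring.Finset
import Mathlib.Algebra.Order.BigOperators.Group.Finset
import Mathlib.Data.Real.Basic
import Mathlib.Data.Fintype.Pi
import Mathlib.Tactic.Ring
import Mathlib.Tactic.FieldSimp
import HarnessLib

/-!
# [IUTchIII] Corollary 3.12, statement — weighted sums over field factors collapse to sums over places

Record-only file (D-0012) of the abc-iut cell (Cor. 3.12 sub-crew, wave 2, seat abc-iut-c312-6, board row W2-C′);
TAKES NO SIDE. Theorems only (finite-sum bookkeeping). `Cor312VolumesReal` / `Cor312VolumesRealFrames` give the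
local `q`-volume of the assembled setting of [IUTchIII] Cor. 3.12 in CLOSED FORM as a weighted sum over the FIELD
FACTORS `K_k` of the completed tensor packet: `qLocal j v_ℚ = Σ_k w_k·μ̇^log_{K_k}(λ_{q,k})`. Seat c312-8's provenance
lemma (`Cor312ProvenanceSum`, p409702) wants it as a sum over the PLACES `v | v_ℚ`:
`−(1/(2l·[F:ℚ]))·Σ_{v bad} ord_v(q_v)·log N(v)`. The passage is elementary arithmetic on the intended weights
([IUTchIII] Rmk. 3.1.1 (ii) p. 94, third display: the normalized weight of the summand indexed by a tuple
`v⃗ = (v_α)_{α ∈ A}` is `(Π_α [K_{v_α}:(F_mod)_{v_α}])⁻¹·(Σ_{w⃗} Π_α [(F_mod)_{w_α}:ℚ_{v_ℚ}])⁻¹`, which multiplies the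
log of the Haar measure of the summand `⊗_α K_{v_α}` — Dupuy–Hilado's `(Π_α Pr(v_α))/dim(⊗_α K_{v_α})`,
`Cor312Bridge.verbatim_weight_eq_dh_weight`), recorded here once, abstractly:

* `sum_factors_eq_sum_tuples` — FIBREWISE COLLAPSE: if the field factors `k` are fibred over tuples `t k`, the weight
  of `k` is `W(t k)/D(t k)` with `D(v⃗) = Σ_{k ∈ t⁻¹(v⃗)} d_k` (`d_k = [K_k:ℚ_p]`, `D = dim`), and the factor quantity is
  `m_k = d_k·c(t k)` (e.g. `μ̇^log_{K_k}(λ) = [K_k:ℚ_p]·log‖λ‖` for a centre coming from the tuple), then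
  `Σ_k w_k·m_k = Σ_{v⃗} W(v⃗)·c(v⃗)`;
* `sum_tuples_prod_mul_last` — MARGINALISATION: `Σ_{v⃗ : Fin (n+1) → V} (Π_α P(v_α))·c(v_n) = (Σ_v P v)^n·Σ_v P(v)·c(v)`,
  `= Σ_v P(v)·c(v)` for probability weights (`sum_tuples_prod_mul_last_of_sum_eq_one`) — the `q`-pilot sits in the
  last tensor factor (label `j`), so its local volume depends on the last coordinate of the tuple only;
* `sum_factors_eq_sum_places` — the two combined: `Σ_k w_k·m_k = Σ_v P(v)·c(v)`.

Pure finite-sum algebra over `ℝ`; no IUT object is defined or asserted. [claim: Mochizuki2012, status: disputed] for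
the quoted weight. Deliberately NOT here: the instantiation (owners of the pieces `e`, `qCentre`: c312-3 / the
assembler of `Setting.ofComparison`), any judgement.
-/

namespace Summit.ABC

namespace IUTFork

namespace Cor312Vol

open Finset

/-- **Fibrewise collapse of a weighted factor sum.** Factors `k : J` fibred over tuples by `t : J → V` (onto), positive
degrees `d_k`, weights `w_k = W(t k) / Σ_{k' ∈ t⁻¹(t k)} d_{k'}`, factor quantities `m_k = d_k·c(t k)`: then
`Σ_k w_k·m_k = Σ_{v⃗} W(v⃗)·c(v⃗)`. [folklore] -/
theorem sum_factors_eq_sum_tuples {J V : Type*} [Fintype J] [Fintype V] [DecidableEq V] (t : J → V)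
    (ht : Function.Surjective t) (d w m : J → ℝ) (W c : V → ℝ) (hd : ∀ k, 0 < d k)
    (hw : ∀ k, w k = W (t k) / ∑ k' ∈ univ.filter (fun k' => t k' = t k), d k')
    (hm : ∀ k, m k = d k * c (t k)) :
    ∑ k, w k * m k = ∑ v, W v * c v := by
  rw [← Finset.sum_fiberwise_of_maps_to (g := t) (fun k _ => Finset.mem_univ (t k))]
  refine Finset.sum_congr rfl fun v _ => ?_
  have hD : 0 < ∑ k' ∈ univ.filter (fun k' => t k' = v), d k' := by
    obtain ⟨k₀, hk₀⟩ := ht v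
    exact Finset.sum_pos (fun k _ => hd k) ⟨k₀, by simp [hk₀]⟩
  have hterm : ∀ k ∈ univ.filter (fun k' => t k' = v),
      w k * m k = (W v * c v / ∑ k' ∈ univ.filter (fun k' => t k' = v), d k') * d k := by
    intro k hk
    have htk : t k = v := (Finset.mem_filter.mp hk).2
    rw [hw k, hm k, htk]
    ring
  rw [Finset.sum_congr rfl hterm, ← Finset.mul_sum, div_mul_cancel₀ _ hD.ne']

/-- **Marginalisation to the last coordinate**: `Σ_{v⃗ : Fin (n+1) → V} (Π_α P(v_α))·c(v_n) = (Σ_v P v)^n·Σ_v P(v)·c(v)`.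
[folklore] -/
theorem sum_tuples_prod_mul_last {V : Type*} [Fintype V] (n : ℕ) (P c : V → ℝ) :
    ∑ f : Fin (n + 1) → V, (∏ i, P (f i)) * c (f (Fin.last n)) = (∑ v, P v) ^ n * ∑ v, P v * c v := by
  classical
  -- the summand as a product over all coordinates of coordinate-dependent factors
  let g : Fin (n + 1) → V → ℝ := fun i v => if i = Fin.last n then P v * c v else P v
  have hg : ∀ f : Fin (n + 1) → V, (∏ i, P (f i)) * c (f (Fin.last n)) = ∏ i, g i (f i) := by
    intro f
    rw [Fin.prod_univ_castSucc, Fin.prod_univ_castSucc]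
    have h1 : ∀ i : Fin n, g (Fin.castSucc i) (f (Fin.castSucc i)) = P (f (Fin.castSucc i)) := fun i => by
      simp only [g, if_neg (Fin.castSucc_lt_last i).ne]
    simp only [h1, g, if_pos rfl]
    ring
  simp_rw [hg]
  rw [← Fintype.prod_sum (fun i v => g i v), Fin.prod_univ_castSucc]
  have h2 : ∀ i : Fin n, (∑ v, g (Fin.castSucc i) v) = ∑ v, P v := fun i =>
    Finset.sum_congr rfl fun v _ => by simp only [g, if_neg (Fin.castSucc_lt_last i).ne]
  simp only [h2, Finset.prod_const, Finset.card_univ, Fintype.card_fin, g, if_pos rfl]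

/-- … `= Σ_v P(v)·c(v)` for PROBABILITY weights `Σ_v P v = 1` (Dupuy–Hilado's `Pr(v)`; Mochizuki's normalized weights
summed against the degrees: S8 `sum_normalizedWeight_mul_degree`). [folklore] -/
theorem sum_tuples_prod_mul_last_of_sum_eq_one {V : Type*} [Fintype V] (n : ℕ) (P c : V → ℝ)
    (hP : ∑ v, P v = 1) :
    ∑ f : Fin (n + 1) → V, (∏ i, P (f i)) * c (f (Fin.last n)) = ∑ v, P v * c v := by
  rw [sum_tuples_prod_mul_last, hP, one_pow, one_mul]

/-- **Field-factor sum = place sum.** Factors `k` of the `(n+1)`-fold packet fibred (onto) over tuples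
`v⃗ : Fin (n+1) → V` of places, degrees `d_k > 0`, weights `w_k = (Π_α P(v_α))/Σ_{k' ∈ fibre} d_{k'}` with `Σ_v P v = 1`,
factor quantities `m_k = d_k·c(v_n)` depending on the LAST place of the tuple only (the `q`-pilot sits in the factor
labelled `j = n`): then `Σ_k w_k·m_k = Σ_v P(v)·c(v)`. [folklore] -/
theorem sum_factors_eq_sum_places {J V : Type*} [Fintype J] [Fintype V] [DecidableEq V] (n : ℕ)
    (t : J → (Fin (n + 1) → V)) (ht : Function.Surjective t) (d w m : J → ℝ) (P c : V → ℝ)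
    (hd : ∀ k, 0 < d k) (hP : ∑ v, P v = 1)
    (hw : ∀ k, w k = (∏ i, P (t k i)) / ∑ k' ∈ univ.filter (fun k' => t k' = t k), d k')
    (hm : ∀ k, m k = d k * c (t k (Fin.last n))) :
    ∑ k, w k * m k = ∑ v, P v * c v := by
  classical
  rw [sum_factors_eq_sum_tuples t ht d w m (fun f => ∏ i, P (f i)) (fun f => c (f (Fin.last n))) hd hw hm]
  exact sum_tuples_prod_mul_last_of_sum_eq_one n P c hP

end Cor312Vol

end IUTFork

end Summit.ABC
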